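import Summits.QuantumFields.YangMills.Theorems.BalabanUVNodesN12AtRecord13OfResiduals
import Literature.MathematicalPhysics.QuantumFieldTheory.Balaban1983to89.Node00.N24NodesStage13FourPinPointedSep

/-!
# BalabanUVNodes ∕ N12 — THE FOUR-PIN STAGE-13 SOCKETS AT THE v1.2 RECORD, N12 RESOLVED: the registered rung `NodesAtSomeRecord13P` and item K1⁗'s θ-keyed consequent over
# dag-n24-c's four-pin ⁗ sockets at a live re-pin carrying K0b's residuals and at the plan's witness `θ₁₅ᶜ` — N12's row from its per-run displays, the guard and N13's (R₁₃) row
# PROVISO-FREE (Track A, DAG node N12 = [B15, Balaban1989LargeFieldI] CMP **122** (1989) 175–202; cluster K1⁗ `StabilityBAtRecordR13Sep` = stmt-QuantumFields-20290; seat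
# `pub-ymgap-dag-n12-d` g8 (R134 s2 «knit at the record»; HANDOFF trigger t22), 2026-08-27; count-neutral, NOT a discharge)

HONEST FRAMING.  Count-neutral kernel COMPOSITION BY NAME — the ⁗ twins of this seat's 12B §4 ∕ 13D §1 ∕ 12E §3 under dag-lead's token map (WORDS-140 (2)) — over dag-n24-c's 40⁗
`Node00/N24NodesStage13FourPinPointedSep` (`N24_nodesAtSomeRecord₁₃Sep_of_fourPin_pointed` = the body of plan g67's registered rung `K1Skeleton13Sep.stub_nodes13P`
at general `N` with the N08 pin `PrintedUV3V N θ.L` as last conjunct, `N24_stabilityBR13Sep_thetaShape18_fourPin_pointed`), node00-def-T's `Node00/Record13` v1.2 (p501191), node00-def-K0a's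
`Record13LiveSelector(Family)` (`liveRepin₁₃`; FILE 9 v1.1 `slotsNondegenerate₁₃_liveRepin_of_hasResiduals`, `admissible_theta13OfNumerics`, `hasResidualsOfRecord_theta13OfNumerics`), K0b's
`HasResidualsOfRecord.ztUnity`, dag-n11-e's `B16RLeafRecord13LiveRstep` (h-FREE `laws₁₃_of_liveSel_of_hasResiduals`, the θ₁₅ᶜ signs) and this seat's 12E `…N12AtRecord13OfResiduals` (N12's row at a
live re-pin from K0b's residuals + the per-run displays) (the W-bundle rows of record).  Nothing of Bałaban's is asserted; item K1⁗ is NOT asserted; the rows N05–N11, N13 (UV₁₃), the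
β-box pair and N12's per-run displays (the (1.100) pin equation, «every LIVE pre-𝐑 term at level `kSel P + 1` has positive mass», Proposition 1 (1.78), (1.80), (1.89), and on runs with
`K ≤ kSel P` the leaf itself) are DISPLAYED hypotheses; the K1⁗-side input is `hP : Provisos₁₃Sep` at the witness, read by the datum and the record predicate ONLY.  N12 is NOT discharged;
no node is discharged; counts unmoved (Track A discharged 5∕28).  ONE finite four-torus programme at fixed `ε = L^{-K}` — nothing continuum ∕ ℝ⁴ ∕ OS ∕ mass gap ∕ Clay.

WHAT THIS FILE GIVES (all count-neutral):
* §1 AT A GENERIC `Θ.liveRepin₁₃`, `Θ` CARRYING K0b's RESIDUALS OF RECORD: ★ `nodesAtSomeRecord₁₃SepP_of_fourPin_liveRepin₁₃_of_massLive_of_hasResiduals` (the rung body `NodesAtSomeRecord13P`,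
  N12's row REPLACED by its per-run displays; guard + N13's (R₁₃) row proviso-free), ★ `stabilityBR13Sep_thetaShape18_fourPin_liveRepin₁₃_of_massLive_of_hasResiduals` (K1⁗'s θ-keyed consequent,
  + β-box pair).  (The h12-HANDED forms at the live re-pin are dag-n24-c's 41⁗ ∕ 42⁗ — not restated here.)
* §2 AT THE PLAN's WITNESS `θ₁₅ᶜ`: ★★ `nodesAtSomeRecord₁₃SepP_of_fourPin_theta13OfThm1C_of_massLive`, ★★ `stabilityBR13Sep_thetaShape18_fourPin_theta13OfThm1C_of_massLive` — K1⁗-side input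
  `hP : Provisos₁₃Sep θ₁₅ᶜ` ALONE.
WHICH CHILD BLOCKS `stub_nodes13P` ON THIS LINE, N12 RESOLVED (kernel = the hypothesis lists below): `hP : Provisos₁₃Sep` at the witness (K0⁗), the world binding at the four-pin view, rows
N05–N11 (N08 the pinned printed sentence), N13 (UV₁₃), and per run N12's displays — live-mass (NODE 00), Prop. 1 at `λ.LF P`, (1.80) ∕ (1.89) at `λ.D189 P` (or their pinned discharges of
14C ∕ 12F), the pin equation (`rfl` at `λ.pinRPrime₁₃`), the `K ≤ kSel P` leaf.

Sources: [Balaban1989LargeFieldI] (0.2)–(0.6) pp.176–177, Prop. 1 p.194, (1.80), (1.89), (1.99)–(1.102); [Balaban1988Convergent] (2.10) p.256, (3.16)–(3.25) pp.268–270;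
[Balaban1989LargeFieldII] Thm 1 + (0.1) pp.355–356, p.391; [Balaban1987RG1] Thm 3 p.264, (1.22) p.264; [Balaban1985UV3] Thm 1 p.257, Thm 2 p.272 (the N08 pin, displayed).
-/

noncomputable section

open MeasureTheory
open scoped Matrix.Norms.L2Operator

namespace Summit.QuantumFields.YangMills.BalabanUVNodes.N12AtRecord13SepSockets

open Literature.MathematicalPhysics.QuantumFieldTheory.Balaban1983to89
open Literature.MathematicalPhysics.QuantumFieldTheory.Balaban1983to89.T4Continuum (T4Family)
open Literature.MathematicalPhysics.QuantumFieldTheory.Balaban1983to89.DagBinding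
open Literature.MathematicalPhysics.QuantumFieldTheory.Balaban1983to89.Node00
open FlowStep (BetaLowerH BetaUpperH)
open FlowStepRuns (genFlow)
open B15Claim189Assembly (new189 chiPP dom)
open B15 (Prop1Printed Ineq180)
open B15.BasicStep (Claim189)
open B8Eq17ClassAkV1 (plaqsOf)
open B15RPrime1100OfRep (rPrimeDataOfSel)
open B16RLeafRecord13AtLive (liveRepin₁₃_liveSel)
open B16RLeafRecord13LiveRstep (laws₁₃_of_liveSel_of_hasResiduals kappa_nonneg_theta13OfThm1C E0_nonneg_theta13OfThm1C B0_nonneg_theta13OfThm1C)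
open Summit.QuantumFields.YangMills.BalabanUVNodes.N12AtRecord13OfResiduals (b15Leaf_WOfRecord₁₃_liveRepin₁₃_all_of_massLive_of_hasResiduals)

variable {N : ℕ} [NeZero N] {F : T4Family}

/-! ## §1 AT THE ₁₃ LIVE RE-PIN OF A PARAMETER `Θ` CARRYING K0b's RESIDUALS — dag-n24-c's four-pin ⁗ sockets with W READ AT THE BUNDLE OF RECORD -/

section Live
variable (Θ : Stage13Params F N) (lamW : ResidW F N)

/-- **★ THE BODY OF THE REGISTERED RUNG `NodesAtSomeRecord13P` (plan g67 `K1Skeleton13Sep.stub_nodes13P`; dag-n24-c 40⁗'s tree shape at general `N`, last conjunct `PrintedUV3V N θ.L` := the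
displayed `h08`) OVER THE FOUR-PIN STAGE-13 VIEW OF THE LIVE RE-PIN, N12's ROW REPLACED BY ITS PER-RUN DISPLAYS** — witnesses `(Θ.liveRepin₁₃, hP, w)`; the GUARD a THEOREM of K0b's residuals
(`HasResidualsOfRecord.ztUnity`, K0a FILE 9 v1.1 `slotsNondegenerate₁₃_liveRepin_of_hasResiduals` — no proviso read), N13's (R₁₃) row by dag-n11-e's h-free `laws₁₃_of_liveSel_of_hasResiduals`, N12's
`h12` by 12E ★★ `b15Leaf_WOfRecord₁₃_liveRepin₁₃_all_of_massLive_of_hasResiduals` (below the torus the pin equation + live-mass + Prop. 1 + (1.80) + (1.89); on runs with `K ≤ kSel P` the leaf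
handed).  WHICH CHILD BLOCKS `stub_nodes13P` on this line = the remaining hypothesis list: `hP : Provisos₁₃Sep` at the re-pin (datum ∕ record predicate only), admissibility, the three
term-constant signs, the world binding, rows N05–N11, N13 (UV₁₃), N12's displays.  COMPOSITE: nothing discharged as a node. [cite: Balaban1989LargeFieldII, Thm 1 p.355, (0.1) pp.355–356; Balaban1989LargeFieldI, (0.2)–(0.6) p.176, Prop. 1 (1.78) p.194, (1.80) p.195, (1.89) p.198, (1.99)–(1.102) pp.200–201; Balaban1988Convergent, Thm 2 p.263, (3.16)–(3.25) pp.268–270; Balaban1985UV3, Thm 1 p.257 + Thm 2 p.272 (the N08 pin, displayed) (bookkeeping)] -/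
theorem nodesAtSomeRecord₁₃SepP_of_fourPin_liveRepin₁₃_of_massLive_of_hasResiduals (hres : Θ.HasResidualsOfRecord F N) (hP : (Θ.liveRepin₁₃ F N).Provisos₁₃Sep F N) (hθ : Θ.Admissible F N)
    (hκ : 0 ≤ Θ.s2.lf.κ) (hE₀ : 0 ≤ Θ.s2.lf.E₀) (hB₀ : 0 ≤ Θ.s2.lf.B₀)
    (Mstar : ℕ) (ops : OpsY N (Θ.liveRepin₁₃ F N).toStage3Params Mstar) (ζ : ResidZ F N) (w : WorldP)
    (hC : w.C = (datumOfRecord₁₃Sep F N (Θ.liveRepin₁₃ F N) hP).C) (hγ : 0 < w.γ ∧ w.γ ≤ (Θ.liveRepin₁₃ F N).γ) (hL : w.L = ((Θ.liveRepin₁₃ F N).L : ℝ))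
    (hup : ∀ P, w.up P = upOfRecord₅C F N ((Θ.liveRepin₁₃ F N).view₁₃B10YZW F N Mstar ops ζ lamW) P)
    (h05 : ∀ P : B12.RunParams,
      B8LeafR ((Θ.liveRepin₁₃ F N).res.X P).d8 ((Θ.liveRepin₁₃ F N).res.X P).L8 ((Θ.liveRepin₁₃ F N).res.X P).C₂ ((Θ.liveRepin₁₃ F N).res.X P).B₁'
        ((Θ.liveRepin₁₃ F N).res.X P).B₀' ((Θ.liveRepin₁₃ F N).res.X P).B₁ ((Θ.liveRepin₁₃ F N).res.X P).B₂ ((Θ.liveRepin₁₃ F N).res.X P).c₁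
        ((Θ.liveRepin₁₃ F N).res.X P).inp8 ((Θ.liveRepin₁₃ F N).res.X P).B₀β ((Θ.liveRepin₁₃ F N).res.X P).loc8 ((Θ.liveRepin₁₃ F N).res.X P).fam8R
        ((Θ.liveRepin₁₃ F N).res.X P).lan8 ((Θ.liveRepin₁₃ F N).res.X P).cub8 ((Θ.liveRepin₁₃ F N).res.X P).toAxial8)
    (h06 : B9LeafX (Y9OfRecord N (Θ.liveRepin₁₃ F N).toStage3Params Mstar ops))
    (h07 : B11Leaf (Z11OfRecord F N ζ))
    (h08 : PrintedUV3V N (Θ.liveRepin₁₃ F N).L)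
    (h09 : ∀ P : B12.RunParams, B12Sec2to5.Lemma4Printed ((Θ.liveRepin₁₃ F N).res.X P).F12 ((Θ.liveRepin₁₃ F N).res.X P).c12)
    (h09T : ∀ P : B12.RunParams, (leavesP w P).smallCouplings → (leavesP w P).smallFieldInductive)
    (h10 : ∀ P : B12.RunParams, B9LeafX (Y9OfRecord N (Θ.liveRepin₁₃ F N).toStage3Params Mstar ops) →
      (B10.Thm1PrintedCompact (((Θ.liveRepin₁₃ F N).view₁₃B10YZW F N Mstar ops ζ lamW).res.X P).runs10 ∧
          B10.Thm2Printed (((Θ.liveRepin₁₃ F N).view₁₃B10YZW F N Mstar ops ζ lamW).res.X P).runs10) →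
        B11Leaf (Z11OfRecord F N ζ) → B12Sec2to5.Lemma4Printed ((Θ.liveRepin₁₃ F N).res.X P).F12 ((Θ.liveRepin₁₃ F N).res.X P).c12 →
          B13.Lemma1Printed ((Θ.liveRepin₁₃ F N).res.X P).S13 ((Θ.liveRepin₁₃ F N).res.X P).c13 ∧
            B13.Lemma2Printed ((Θ.liveRepin₁₃ F N).res.X P).S13 ((Θ.liveRepin₁₃ F N).res.X P).c13 ∧
            B13.Lemma3Printed ((Θ.liveRepin₁₃ F N).res.X P).S13 ((Θ.liveRepin₁₃ F N).res.X P).c13)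
    (h11 : ∀ P : B12.RunParams, (leavesP w P).b7 → (leavesP w P).b8 → (leavesP w P).b9 → (leavesP w P).b10 → (leavesP w P).b11 →
      (leavesP w P).smallCouplings → (leavesP w P).smallFieldInductive → (leavesP w P).flowControl →
        ∀ k, k < P.K → SLaw₁₃ F N (Θ.liveRepin₁₃ F N) P k → TLaw₁₃ F N (Θ.liveRepin₁₃ F N) P k)
    -- N12's displays, run by run
    (h12deg : ∀ P : B12.RunParams, P.K ≤ lamW.kSel P → B15Leaf (WOfRecord₁₃ F N (Θ.liveRepin₁₃ F N) lamW P))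
    (h12pin : ∀ P : B12.RunParams, lamW.kSel P < P.K → lamW.D1100 P
      = rPrimeDataOfSel (reprTOfRecord₁₃ F N (Θ.liveRepin₁₃ F N) P (lamW.kSel P))
          ((Θ.liveRepin₁₃ F N).ppSel P (gOfRecord₁₃ F N (Θ.liveRepin₁₃ F N) P) (lamW.kSel P + 1))
          (fibOfSeq F (Θ.liveRepin₁₃ F N).ν (Θ.liveRepin₁₃ F N).τ9 P (gOfRecord₁₃ F N (Θ.liveRepin₁₃ F N) P) (lamW.kSel P + 1)))
    (h12mass : ∀ P : B12.RunParams, lamW.kSel P < P.K → ∀ s, LiveSeq F N Θ.ν Θ.τ9 P (gOfRecord₁₃ F N (Θ.liveRepin₁₃ F N) P) (lamW.kSel P + 1)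
        (slotsTOfRecord F N Θ.ν Θ.τ9 (EOfRecord₁₃ F N (Θ.liveRepin₁₃ F N)) (wOfRecord₉ F N (Θ.liveRepin₁₃ F N).toStage9Params)
          (Θ.liveRepin₁₃ F N).ppSel P (gOfRecord₁₃ F N (Θ.liveRepin₁₃ F N) P) (lamW.kSel P + 1)) s →
      0 < ∫ V, rterm (reprTOfRecord₁₃ F N (Θ.liveRepin₁₃ F N) P (lamW.kSel P)) s V ∂(fieldMeasure (F.P P.K) (lamW.kSel P + 1) (SU N)))
    (h12P1 : ∀ P : B12.RunParams, lamW.kSel P < P.K → Prop1Printed (lamW.LF P))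
    (h12i180 : ∀ P : B12.RunParams, lamW.kSel P < P.K → ∀ U, new189 (lamW.D189 P) U → ∀ i, (lamW.D189 P).h ≤ i → i ≤ (lamW.D189 P).k →
      ∀ q ∈ plaqsOf (dom (lamW.D189 P) i),
        Ineq180 ((lamW.D189 P).dev0 U q) ((lamW.D189 P).ε (lamW.D189 P).k) (lamW.D189 P).η (lamW.D189 P).B₃ (lamW.D189 P).B₅ (lamW.D189 P).M (lamW.D189 P).δ
          ((lamW.D189 P).dist q) (lamW.D189 P).O1)
    (h12c189 : ∀ P : B12.RunParams, lamW.kSel P < P.K → Claim189 (new189 (lamW.D189 P)) (chiPP (lamW.D189 P)))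
    (hUV : ∀ P : B12.RunParams, (genFlow (betaOfRecord₁₃ F N (Θ.liveRepin₁₃ F N)) P.g0).InInterval w.γ P.K → ∀ k, k ≤ P.K →
      SLaw₁₃ F N (Θ.liveRepin₁₃ F N) P k → ∀ U : GaugeField (F.P P.K) k (SU N),
        chiβOfRecord₁₃ F N (Θ.liveRepin₁₃ F N) P.K (gOfRecord₁₃ F N (Θ.liveRepin₁₃ F N) P) k U *
              Real.exp (-(1 / (gOfRecord₁₃ F N (Θ.liveRepin₁₃ F N) P k) ^ 2 * wilsonBGOfRecord F N (Θ.liveRepin₁₃ F N).εbg P k U)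
                - w.em (gOfRecord₁₃ F N (Θ.liveRepin₁₃ F N) P k) * (Fintype.card (Site (F.P P.K) k) : ℝ)) ≤
            densOfRecord₁₃ F N (Θ.liveRepin₁₃ F N) P k U ∧
        densOfRecord₁₃ F N (Θ.liveRepin₁₃ F N) P k U ≤ Real.exp (w.ep (gOfRecord₁₃ F N (Θ.liveRepin₁₃ F N) P k) * (Fintype.card (Site (F.P P.K) k) : ℝ))) :
    ∃ (θ' : Stage13Params F N) (h' : θ'.Provisos₁₃Sep F N) (w' : WorldP), (θ'.ZtUnity F N ∧ θ'.SlotsNondegenerate₁₃ F N) ∧ θ'.Admissible F N ∧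
      IsRecordOfRecord₁₃CSep F N (datumOfRecord₁₃Sep F N θ' h') w' ∧ (∀ P : B12.RunParams, Nodes (leavesP w' P)) ∧ PrintedUV3V N θ'.L :=
  N24_nodesAtSomeRecord₁₃Sep_of_fourPin_pointed (Θ.liveRepin₁₃ F N) hP hθ.liveRepin₁₃
    ⟨Stage13Params.ZtUnity.liveRepin₁₃ hres.ztUnity, Stage13Params.slotsNondegenerate₁₃_liveRepin_of_hasResiduals hres⟩ Mstar ops ζ lamW w hC hγ hL hup h05 h06 h07 h08 h09 h09T h10 h11
    (b15Leaf_WOfRecord₁₃_liveRepin₁₃_all_of_massLive_of_hasResiduals Θ lamW hres h12deg h12pin h12mass h12P1 h12i180 h12c189)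
    (fun P k hk => laws₁₃_of_liveSel_of_hasResiduals F N (Θ.liveRepin₁₃ F N) P (Stage13Params.HasResidualsOfRecord.liveRepin₁₃ hres) hθ.liveRepin₁₃ hκ hE₀ hB₀ (liveRepin₁₃_liveSel F N Θ) k hk) hUV

/-- **★ THE CONSEQUENT OF ITEM K1⁗ `StabilityBAtRecordR13Sep` (rev 18, stmt-QuantumFields-20290) IN ITS θ-KEYED SHAPE, WITNESSED BY `(Θ.liveRepin₁₃, hP)` OVER THE FOUR-PIN VIEW, N12's ROW
REPLACED BY ITS PER-RUN DISPLAYS** (dag-n24-c 40⁗'s `N24_stabilityBR13Sep_thetaShape18_fourPin_pointed` at the live re-pin: guard, N13's (R₁₃) row DISCHARGED BY NAME from K0b's residuals; N12 by 12E;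
β-box pair and every other row displayed).  COMPOSITE: nothing is discharged. [cite: Balaban1989LargeFieldII, Thm 1 p.355, (0.1) pp.355–356, p.391; Balaban1989LargeFieldI, (0.2)–(0.6) p.176, Prop. 1 (1.78) p.194, (1.80) p.195, (1.89) p.198, (1.99)–(1.102) pp.200–201; Balaban1987RG1, Thm 3 p.264, (1.22) p.264; Balaban1988Convergent, (3.22)–(3.25) pp.269–270 (bookkeeping + elementary window)] -/
theorem stabilityBR13Sep_thetaShape18_fourPin_liveRepin₁₃_of_massLive_of_hasResiduals (hres : Θ.HasResidualsOfRecord F N) (hP : (Θ.liveRepin₁₃ F N).Provisos₁₃Sep F N) (hθ : Θ.Admissible F N)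
    (hκ : 0 ≤ Θ.s2.lf.κ) (hE₀ : 0 ≤ Θ.s2.lf.E₀) (hB₀ : 0 ≤ Θ.s2.lf.B₀)
    (Mstar : ℕ) (ops : OpsY N (Θ.liveRepin₁₃ F N).toStage3Params Mstar) (ζ : ResidZ F N) (w : WorldP)
    (hC : w.C = (datumOfRecord₁₃Sep F N (Θ.liveRepin₁₃ F N) hP).C) (hγ : 0 < w.γ ∧ w.γ ≤ (Θ.liveRepin₁₃ F N).γ) (hL : w.L = ((Θ.liveRepin₁₃ F N).L : ℝ))
    (hup : ∀ P, w.up P = upOfRecord₅C F N ((Θ.liveRepin₁₃ F N).view₁₃B10YZW F N Mstar ops ζ lamW) P)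
    (h05 : ∀ P : B12.RunParams,
      B8LeafR ((Θ.liveRepin₁₃ F N).res.X P).d8 ((Θ.liveRepin₁₃ F N).res.X P).L8 ((Θ.liveRepin₁₃ F N).res.X P).C₂ ((Θ.liveRepin₁₃ F N).res.X P).B₁'
        ((Θ.liveRepin₁₃ F N).res.X P).B₀' ((Θ.liveRepin₁₃ F N).res.X P).B₁ ((Θ.liveRepin₁₃ F N).res.X P).B₂ ((Θ.liveRepin₁₃ F N).res.X P).c₁
        ((Θ.liveRepin₁₃ F N).res.X P).inp8 ((Θ.liveRepin₁₃ F N).res.X P).B₀β ((Θ.liveRepin₁₃ F N).res.X P).loc8 ((Θ.liveRepin₁₃ F N).res.X P).fam8R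
        ((Θ.liveRepin₁₃ F N).res.X P).lan8 ((Θ.liveRepin₁₃ F N).res.X P).cub8 ((Θ.liveRepin₁₃ F N).res.X P).toAxial8)
    (h06 : B9LeafX (Y9OfRecord N (Θ.liveRepin₁₃ F N).toStage3Params Mstar ops))
    (h07 : B11Leaf (Z11OfRecord F N ζ))
    (h08 : PrintedUV3V N (Θ.liveRepin₁₃ F N).L)
    (h09 : ∀ P : B12.RunParams, B12Sec2to5.Lemma4Printed ((Θ.liveRepin₁₃ F N).res.X P).F12 ((Θ.liveRepin₁₃ F N).res.X P).c12)
    (h09T : ∀ P : B12.RunParams, (leavesP w P).smallCouplings → (leavesP w P).smallFieldInductive)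
    (h10 : ∀ P : B12.RunParams, B9LeafX (Y9OfRecord N (Θ.liveRepin₁₃ F N).toStage3Params Mstar ops) →
      (B10.Thm1PrintedCompact (((Θ.liveRepin₁₃ F N).view₁₃B10YZW F N Mstar ops ζ lamW).res.X P).runs10 ∧
          B10.Thm2Printed (((Θ.liveRepin₁₃ F N).view₁₃B10YZW F N Mstar ops ζ lamW).res.X P).runs10) →
        B11Leaf (Z11OfRecord F N ζ) → B12Sec2to5.Lemma4Printed ((Θ.liveRepin₁₃ F N).res.X P).F12 ((Θ.liveRepin₁₃ F N).res.X P).c12 →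
          B13.Lemma1Printed ((Θ.liveRepin₁₃ F N).res.X P).S13 ((Θ.liveRepin₁₃ F N).res.X P).c13 ∧
            B13.Lemma2Printed ((Θ.liveRepin₁₃ F N).res.X P).S13 ((Θ.liveRepin₁₃ F N).res.X P).c13 ∧
            B13.Lemma3Printed ((Θ.liveRepin₁₃ F N).res.X P).S13 ((Θ.liveRepin₁₃ F N).res.X P).c13)
    (h11 : ∀ P : B12.RunParams, (leavesP w P).b7 → (leavesP w P).b8 → (leavesP w P).b9 → (leavesP w P).b10 → (leavesP w P).b11 →
      (leavesP w P).smallCouplings → (leavesP w P).smallFieldInductive → (leavesP w P).flowControl →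
        ∀ k, k < P.K → SLaw₁₃ F N (Θ.liveRepin₁₃ F N) P k → TLaw₁₃ F N (Θ.liveRepin₁₃ F N) P k)
    (h12deg : ∀ P : B12.RunParams, P.K ≤ lamW.kSel P → B15Leaf (WOfRecord₁₃ F N (Θ.liveRepin₁₃ F N) lamW P))
    (h12pin : ∀ P : B12.RunParams, lamW.kSel P < P.K → lamW.D1100 P
      = rPrimeDataOfSel (reprTOfRecord₁₃ F N (Θ.liveRepin₁₃ F N) P (lamW.kSel P))
          ((Θ.liveRepin₁₃ F N).ppSel P (gOfRecord₁₃ F N (Θ.liveRepin₁₃ F N) P) (lamW.kSel P + 1))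
          (fibOfSeq F (Θ.liveRepin₁₃ F N).ν (Θ.liveRepin₁₃ F N).τ9 P (gOfRecord₁₃ F N (Θ.liveRepin₁₃ F N) P) (lamW.kSel P + 1)))
    (h12mass : ∀ P : B12.RunParams, lamW.kSel P < P.K → ∀ s, LiveSeq F N Θ.ν Θ.τ9 P (gOfRecord₁₃ F N (Θ.liveRepin₁₃ F N) P) (lamW.kSel P + 1)
        (slotsTOfRecord F N Θ.ν Θ.τ9 (EOfRecord₁₃ F N (Θ.liveRepin₁₃ F N)) (wOfRecord₉ F N (Θ.liveRepin₁₃ F N).toStage9Params)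
          (Θ.liveRepin₁₃ F N).ppSel P (gOfRecord₁₃ F N (Θ.liveRepin₁₃ F N) P) (lamW.kSel P + 1)) s →
      0 < ∫ V, rterm (reprTOfRecord₁₃ F N (Θ.liveRepin₁₃ F N) P (lamW.kSel P)) s V ∂(fieldMeasure (F.P P.K) (lamW.kSel P + 1) (SU N)))
    (h12P1 : ∀ P : B12.RunParams, lamW.kSel P < P.K → Prop1Printed (lamW.LF P))
    (h12i180 : ∀ P : B12.RunParams, lamW.kSel P < P.K → ∀ U, new189 (lamW.D189 P) U → ∀ i, (lamW.D189 P).h ≤ i → i ≤ (lamW.D189 P).k →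
      ∀ q ∈ plaqsOf (dom (lamW.D189 P) i),
        Ineq180 ((lamW.D189 P).dev0 U q) ((lamW.D189 P).ε (lamW.D189 P).k) (lamW.D189 P).η (lamW.D189 P).B₃ (lamW.D189 P).B₅ (lamW.D189 P).M (lamW.D189 P).δ
          ((lamW.D189 P).dist q) (lamW.D189 P).O1)
    (h12c189 : ∀ P : B12.RunParams, lamW.kSel P < P.K → Claim189 (new189 (lamW.D189 P)) (chiPP (lamW.D189 P)))
    (hUV : ∀ P : B12.RunParams, (genFlow (betaOfRecord₁₃ F N (Θ.liveRepin₁₃ F N)) P.g0).InInterval w.γ P.K → ∀ k, k ≤ P.K →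
      SLaw₁₃ F N (Θ.liveRepin₁₃ F N) P k → ∀ U : GaugeField (F.P P.K) k (SU N),
        chiβOfRecord₁₃ F N (Θ.liveRepin₁₃ F N) P.K (gOfRecord₁₃ F N (Θ.liveRepin₁₃ F N) P) k U *
              Real.exp (-(1 / (gOfRecord₁₃ F N (Θ.liveRepin₁₃ F N) P k) ^ 2 * wilsonBGOfRecord F N (Θ.liveRepin₁₃ F N).εbg P k U)
                - w.em (gOfRecord₁₃ F N (Θ.liveRepin₁₃ F N) P k) * (Fintype.card (Site (F.P P.K) k) : ℝ)) ≤
            densOfRecord₁₃ F N (Θ.liveRepin₁₃ F N) P k U ∧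
        densOfRecord₁₃ F N (Θ.liveRepin₁₃ F N) P k U ≤ Real.exp (w.ep (gOfRecord₁₃ F N (Θ.liveRepin₁₃ F N) P k) * (Fintype.card (Site (F.P P.K) k) : ℝ)))
    (hlo : BetaLowerH w.b w.γ (datumOfRecord₁₃Sep F N (Θ.liveRepin₁₃ F N) hP).βfun)
    (hhi : BetaUpperH w.βup w.γ (datumOfRecord₁₃Sep F N (Θ.liveRepin₁₃ F N) hP).βfun) :
    ∃ (θ' : Stage13Params F N) (h' : θ'.Provisos₁₃Sep F N), (θ'.ZtUnity F N ∧ θ'.SlotsNondegenerate₁₃ F N) ∧ θ'.Admissible F N ∧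
      B16.EndStatementBPrinted (datumOfRecord₁₃Sep F N θ' h').C ∧
      ∃ γ₁ : ℝ, 0 < γ₁ ∧ ∀ γ : ℝ, 0 < γ → γ ≤ γ₁ → ∃ P : B12.RunParams, 1 ≤ P.K ∧ ((datumOfRecord₁₃Sep F N θ' h').C P).flow.InInterval γ P.K :=
  N24_stabilityBR13Sep_thetaShape18_fourPin_pointed (Θ.liveRepin₁₃ F N) hP hθ.liveRepin₁₃
    ⟨Stage13Params.ZtUnity.liveRepin₁₃ hres.ztUnity, Stage13Params.slotsNondegenerate₁₃_liveRepin_of_hasResiduals hres⟩ Mstar ops ζ lamW w hC hγ hL hup h05 h06 h07 h08 h09 h09T h10 h11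
    (b15Leaf_WOfRecord₁₃_liveRepin₁₃_all_of_massLive_of_hasResiduals Θ lamW hres h12deg h12pin h12mass h12P1 h12i180 h12c189)
    (fun P k hk => laws₁₃_of_liveSel_of_hasResiduals F N (Θ.liveRepin₁₃ F N) P (Stage13Params.HasResidualsOfRecord.liveRepin₁₃ hres) hθ.liveRepin₁₃ hκ hE₀ hB₀ (liveRepin₁₃_liveSel F N Θ) k hk) hUV hlo hhi


end Live

/-! ## §2 AT THE PLAN's `L`-KEYED WITNESS `θ₁₅ᶜ = theta13OfThm1C F N ε₀ ε₂₉ B₃ a₀ a₁` — the rung body and K1⁗'s θ-keyed consequent, N12 resolved -/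

section Thm1C
variable (ε₀ ε₂₉ B₃ a₀ a₁ : ℝ) (lamW : ResidW F N)

/-- **★★ THE BODY OF THE REGISTERED RUNG `NodesAtSomeRecord13P` OVER THE FOUR-PIN STAGE-13 VIEW AT THE PLAN's `L`-KEYED WITNESS `θ₁₅ᶜ = theta13OfThm1C F N ε₀ ε₂₉ B₃ a₀ a₁`, N12's ROW
REPLACED BY ITS PER-RUN DISPLAYS** — §1 at `Θ := theta13OfNumerics … (stage12NumericsOfThm1C F.L ε₀ B₃ a₀ a₁) …` (whose ₁₃ live re-pin IS `θ₁₅ᶜ`): K0b's residuals by K0a's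
`hasResidualsOfRecord_theta13OfNumerics`, admissibility by K0a's `admissible_theta13OfNumerics` + `stage12NumericsOfThm1C_pos` under the five witness signs, the term-constant signs by dag-n11-e's
`kappa∕E0∕B0_nonneg_theta13OfThm1C`.  K1⁗-SIDE INPUT: `hP : Provisos₁₃Sep θ₁₅ᶜ` ALONE (read by the datum `datumOfRecord₁₃Sep … hP` and the record predicate; the guard, N12's and N13's rows need it
NOT); displayed: the world binding at the four-pin view, rows N05–N11 (N08 = the pinned printed sentence `h08`), N13 (UV₁₃), N12's printed displays per run.  COMPOSITE: nothing discharged as a node.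
[cite: Balaban1989LargeFieldII, Thm 1 p.355, (0.1) pp.355–356; Balaban1989LargeFieldI, (0.2)–(0.6) p.176, Prop. 1 (1.78) p.194, (1.80) p.195, (1.89) p.198, (1.99)–(1.102) pp.200–201; Balaban1988Convergent, (2.10) p.256, (3.16)–(3.25) pp.268–270; Balaban1985Variational, Thm 1 p.279 (witness letters only)] -/
theorem nodesAtSomeRecord₁₃SepP_of_fourPin_theta13OfThm1C_of_massLive (hε : 0 < ε₀) (hε' : 0 < ε₂₉) (hB : 0 ≤ B₃) (ha₀ : 0 < a₀) (ha₁ : 0 < a₁)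
    (hP : (theta13OfThm1C F N ε₀ ε₂₉ B₃ a₀ a₁).Provisos₁₃Sep F N)
    (Mstar : ℕ) (ops : OpsY N (theta13OfThm1C F N ε₀ ε₂₉ B₃ a₀ a₁).toStage3Params Mstar) (ζ : ResidZ F N) (w : WorldP)
    (hC : w.C = (datumOfRecord₁₃Sep F N (theta13OfThm1C F N ε₀ ε₂₉ B₃ a₀ a₁) hP).C) (hγ : 0 < w.γ ∧ w.γ ≤ (theta13OfThm1C F N ε₀ ε₂₉ B₃ a₀ a₁).γ) (hL : w.L = ((theta13OfThm1C F N ε₀ ε₂₉ B₃ a₀ a₁).L : ℝ))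
    (hup : ∀ P, w.up P = upOfRecord₅C F N ((theta13OfThm1C F N ε₀ ε₂₉ B₃ a₀ a₁).view₁₃B10YZW F N Mstar ops ζ lamW) P)
    (h05 : ∀ P : B12.RunParams,
      B8LeafR ((theta13OfThm1C F N ε₀ ε₂₉ B₃ a₀ a₁).res.X P).d8 ((theta13OfThm1C F N ε₀ ε₂₉ B₃ a₀ a₁).res.X P).L8 ((theta13OfThm1C F N ε₀ ε₂₉ B₃ a₀ a₁).res.X P).C₂ ((theta13OfThm1C F N ε₀ ε₂₉ B₃ a₀ a₁).res.X P).B₁'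
        ((theta13OfThm1C F N ε₀ ε₂₉ B₃ a₀ a₁).res.X P).B₀' ((theta13OfThm1C F N ε₀ ε₂₉ B₃ a₀ a₁).res.X P).B₁ ((theta13OfThm1C F N ε₀ ε₂₉ B₃ a₀ a₁).res.X P).B₂ ((theta13OfThm1C F N ε₀ ε₂₉ B₃ a₀ a₁).res.X P).c₁
        ((theta13OfThm1C F N ε₀ ε₂₉ B₃ a₀ a₁).res.X P).inp8 ((theta13OfThm1C F N ε₀ ε₂₉ B₃ a₀ a₁).res.X P).B₀β ((theta13OfThm1C F N ε₀ ε₂₉ B₃ a₀ a₁).res.X P).loc8 ((theta13OfThm1C F N ε₀ ε₂₉ B₃ a₀ a₁).res.X P).fam8R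
        ((theta13OfThm1C F N ε₀ ε₂₉ B₃ a₀ a₁).res.X P).lan8 ((theta13OfThm1C F N ε₀ ε₂₉ B₃ a₀ a₁).res.X P).cub8 ((theta13OfThm1C F N ε₀ ε₂₉ B₃ a₀ a₁).res.X P).toAxial8)
    (h06 : B9LeafX (Y9OfRecord N (theta13OfThm1C F N ε₀ ε₂₉ B₃ a₀ a₁).toStage3Params Mstar ops))
    (h07 : B11Leaf (Z11OfRecord F N ζ))
    (h08 : PrintedUV3V N (theta13OfThm1C F N ε₀ ε₂₉ B₃ a₀ a₁).L)
    (h09 : ∀ P : B12.RunParams, B12Sec2to5.Lemma4Printed ((theta13OfThm1C F N ε₀ ε₂₉ B₃ a₀ a₁).res.X P).F12 ((theta13OfThm1C F N ε₀ ε₂₉ B₃ a₀ a₁).res.X P).c12)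
    (h09T : ∀ P : B12.RunParams, (leavesP w P).smallCouplings → (leavesP w P).smallFieldInductive)
    (h10 : ∀ P : B12.RunParams, B9LeafX (Y9OfRecord N (theta13OfThm1C F N ε₀ ε₂₉ B₃ a₀ a₁).toStage3Params Mstar ops) →
      (B10.Thm1PrintedCompact (((theta13OfThm1C F N ε₀ ε₂₉ B₃ a₀ a₁).view₁₃B10YZW F N Mstar ops ζ lamW).res.X P).runs10 ∧
          B10.Thm2Printed (((theta13OfThm1C F N ε₀ ε₂₉ B₃ a₀ a₁).view₁₃B10YZW F N Mstar ops ζ lamW).res.X P).runs10) →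
        B11Leaf (Z11OfRecord F N ζ) → B12Sec2to5.Lemma4Printed ((theta13OfThm1C F N ε₀ ε₂₉ B₃ a₀ a₁).res.X P).F12 ((theta13OfThm1C F N ε₀ ε₂₉ B₃ a₀ a₁).res.X P).c12 →
          B13.Lemma1Printed ((theta13OfThm1C F N ε₀ ε₂₉ B₃ a₀ a₁).res.X P).S13 ((theta13OfThm1C F N ε₀ ε₂₉ B₃ a₀ a₁).res.X P).c13 ∧
            B13.Lemma2Printed ((theta13OfThm1C F N ε₀ ε₂₉ B₃ a₀ a₁).res.X P).S13 ((theta13OfThm1C F N ε₀ ε₂₉ B₃ a₀ a₁).res.X P).c13 ∧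
            B13.Lemma3Printed ((theta13OfThm1C F N ε₀ ε₂₉ B₃ a₀ a₁).res.X P).S13 ((theta13OfThm1C F N ε₀ ε₂₉ B₃ a₀ a₁).res.X P).c13)
    (h11 : ∀ P : B12.RunParams, (leavesP w P).b7 → (leavesP w P).b8 → (leavesP w P).b9 → (leavesP w P).b10 → (leavesP w P).b11 →
      (leavesP w P).smallCouplings → (leavesP w P).smallFieldInductive → (leavesP w P).flowControl →
        ∀ k, k < P.K → SLaw₁₃ F N (theta13OfThm1C F N ε₀ ε₂₉ B₃ a₀ a₁) P k → TLaw₁₃ F N (theta13OfThm1C F N ε₀ ε₂₉ B₃ a₀ a₁) P k)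
    (h12deg : ∀ P : B12.RunParams, P.K ≤ lamW.kSel P → B15Leaf (WOfRecord₁₃ F N (theta13OfThm1C F N ε₀ ε₂₉ B₃ a₀ a₁) lamW P))
    (h12pin : ∀ P : B12.RunParams, lamW.kSel P < P.K → lamW.D1100 P
      = rPrimeDataOfSel (reprTOfRecord₁₃ F N (theta13OfThm1C F N ε₀ ε₂₉ B₃ a₀ a₁) P (lamW.kSel P))
          ((theta13OfThm1C F N ε₀ ε₂₉ B₃ a₀ a₁).ppSel P (gOfRecord₁₃ F N (theta13OfThm1C F N ε₀ ε₂₉ B₃ a₀ a₁) P) (lamW.kSel P + 1))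
          (fibOfSeq F (theta13OfThm1C F N ε₀ ε₂₉ B₃ a₀ a₁).ν (theta13OfThm1C F N ε₀ ε₂₉ B₃ a₀ a₁).τ9 P (gOfRecord₁₃ F N (theta13OfThm1C F N ε₀ ε₂₉ B₃ a₀ a₁) P) (lamW.kSel P + 1)))
    (h12mass : ∀ P : B12.RunParams, lamW.kSel P < P.K → ∀ s, LiveSeq F N (theta13OfThm1C F N ε₀ ε₂₉ B₃ a₀ a₁).ν (theta13OfThm1C F N ε₀ ε₂₉ B₃ a₀ a₁).τ9 P (gOfRecord₁₃ F N (theta13OfThm1C F N ε₀ ε₂₉ B₃ a₀ a₁) P) (lamW.kSel P + 1)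
        (slotsTOfRecord F N (theta13OfThm1C F N ε₀ ε₂₉ B₃ a₀ a₁).ν (theta13OfThm1C F N ε₀ ε₂₉ B₃ a₀ a₁).τ9 (EOfRecord₁₃ F N (theta13OfThm1C F N ε₀ ε₂₉ B₃ a₀ a₁)) (wOfRecord₉ F N (theta13OfThm1C F N ε₀ ε₂₉ B₃ a₀ a₁).toStage9Params)
          (theta13OfThm1C F N ε₀ ε₂₉ B₃ a₀ a₁).ppSel P (gOfRecord₁₃ F N (theta13OfThm1C F N ε₀ ε₂₉ B₃ a₀ a₁) P) (lamW.kSel P + 1)) s →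
      0 < ∫ V, rterm (reprTOfRecord₁₃ F N (theta13OfThm1C F N ε₀ ε₂₉ B₃ a₀ a₁) P (lamW.kSel P)) s V ∂(fieldMeasure (F.P P.K) (lamW.kSel P + 1) (SU N)))
    (h12P1 : ∀ P : B12.RunParams, lamW.kSel P < P.K → Prop1Printed (lamW.LF P))
    (h12i180 : ∀ P : B12.RunParams, lamW.kSel P < P.K → ∀ U, new189 (lamW.D189 P) U → ∀ i, (lamW.D189 P).h ≤ i → i ≤ (lamW.D189 P).k →
      ∀ q ∈ plaqsOf (dom (lamW.D189 P) i),
        Ineq180 ((lamW.D189 P).dev0 U q) ((lamW.D189 P).ε (lamW.D189 P).k) (lamW.D189 P).η (lamW.D189 P).B₃ (lamW.D189 P).B₅ (lamW.D189 P).M (lamW.D189 P).δ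
          ((lamW.D189 P).dist q) (lamW.D189 P).O1)
    (h12c189 : ∀ P : B12.RunParams, lamW.kSel P < P.K → Claim189 (new189 (lamW.D189 P)) (chiPP (lamW.D189 P)))
    (hUV : ∀ P : B12.RunParams, (genFlow (betaOfRecord₁₃ F N (theta13OfThm1C F N ε₀ ε₂₉ B₃ a₀ a₁)) P.g0).InInterval w.γ P.K → ∀ k, k ≤ P.K →
      SLaw₁₃ F N (theta13OfThm1C F N ε₀ ε₂₉ B₃ a₀ a₁) P k → ∀ U : GaugeField (F.P P.K) k (SU N),
        chiβOfRecord₁₃ F N (theta13OfThm1C F N ε₀ ε₂₉ B₃ a₀ a₁) P.K (gOfRecord₁₃ F N (theta13OfThm1C F N ε₀ ε₂₉ B₃ a₀ a₁) P) k U *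
              Real.exp (-(1 / (gOfRecord₁₃ F N (theta13OfThm1C F N ε₀ ε₂₉ B₃ a₀ a₁) P k) ^ 2 * wilsonBGOfRecord F N (theta13OfThm1C F N ε₀ ε₂₉ B₃ a₀ a₁).εbg P k U)
                - w.em (gOfRecord₁₃ F N (theta13OfThm1C F N ε₀ ε₂₉ B₃ a₀ a₁) P k) * (Fintype.card (Site (F.P P.K) k) : ℝ)) ≤
            densOfRecord₁₃ F N (theta13OfThm1C F N ε₀ ε₂₉ B₃ a₀ a₁) P k U ∧
        densOfRecord₁₃ F N (theta13OfThm1C F N ε₀ ε₂₉ B₃ a₀ a₁) P k U ≤ Real.exp (w.ep (gOfRecord₁₃ F N (theta13OfThm1C F N ε₀ ε₂₉ B₃ a₀ a₁) P k) * (Fintype.card (Site (F.P P.K) k) : ℝ))) :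
    ∃ (θ' : Stage13Params F N) (h' : θ'.Provisos₁₃Sep F N) (w' : WorldP), (θ'.ZtUnity F N ∧ θ'.SlotsNondegenerate₁₃ F N) ∧ θ'.Admissible F N ∧
      IsRecordOfRecord₁₃CSep F N (datumOfRecord₁₃Sep F N θ' h') w' ∧ (∀ P : B12.RunParams, Nodes (leavesP w' P)) ∧ PrintedUV3V N θ'.L :=
  nodesAtSomeRecord₁₃SepP_of_fourPin_liveRepin₁₃_of_massLive_of_hasResiduals
    (theta13OfNumerics F N (stage12NumericsOfThm1C F.L ε₀ B₃ a₀ a₁) ε₂₉ (zeta316OfRecord F N (stage12NumericsOfThm1C F.L ε₀ B₃ a₀ a₁).ν (stage12NumericsOfThm1C F.L ε₀ B₃ a₀ a₁).τ9.M (stage12NumericsOfThm1C F.L ε₀ B₃ a₀ a₁).A₁) (RzOfRecord F N) (ZtOfRecord F N)) lamW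
    (hasResidualsOfRecord_theta13OfNumerics F N (stage12NumericsOfThm1C F.L ε₀ B₃ a₀ a₁) ε₂₉) hP
    (admissible_theta13OfNumerics F N (zeta316OfRecord F N (stage12NumericsOfThm1C F.L ε₀ B₃ a₀ a₁).ν (stage12NumericsOfThm1C F.L ε₀ B₃ a₀ a₁).τ9.M (stage12NumericsOfThm1C F.L ε₀ B₃ a₀ a₁).A₁) (RzOfRecord F N) (ZtOfRecord F N) (stage12NumericsOfThm1C_pos hε hB ha₀ ha₁) hε')
    (kappa_nonneg_theta13OfThm1C F N ε₀ ε₂₉ B₃ a₀ a₁) (E0_nonneg_theta13OfThm1C F N ε₀ ε₂₉ B₃ a₀ a₁)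
    (B0_nonneg_theta13OfThm1C F N ε₀ ε₂₉ B₃ a₀ a₁) Mstar ops ζ w hC hγ hL hup h05 h06 h07 h08 h09 h09T h10 h11 h12deg h12pin h12mass h12P1 h12i180 h12c189 hUV

/-- **★★ THE CONSEQUENT OF ITEM K1⁗ `StabilityBAtRecordR13Sep` IN ITS θ-KEYED SHAPE, WITNESSED BY `(θ₁₅ᶜ, hP)` OVER THE FOUR-PIN VIEW, N12's ROW REPLACED BY ITS PER-RUN DISPLAYS** (§1 at the
numerics member; `n.Pos`, signs, `Admissible`, `ZtUnity`, guard, N13's (R₁₃) row DISCHARGED BY NAME; `hP : Provisos₁₃Sep θ₁₅ᶜ` for the datum, the β-box pair and every other row displayed).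
COMPOSITE: nothing is discharged. [cite: Balaban1989LargeFieldII, Thm 1 p.355, (0.1) pp.355–356, p.391; Balaban1989LargeFieldI, (0.2)–(0.6) p.176, Prop. 1 (1.78) p.194, (1.80) p.195, (1.89) p.198, (1.99)–(1.102) pp.200–201; Balaban1987RG1, Thm 3 p.264, (1.22) p.264; Balaban1988Convergent, (3.22)–(3.25) pp.269–270 (bookkeeping + elementary window)] -/
theorem stabilityBR13Sep_thetaShape18_fourPin_theta13OfThm1C_of_massLive (hε : 0 < ε₀) (hε' : 0 < ε₂₉) (hB : 0 ≤ B₃) (ha₀ : 0 < a₀) (ha₁ : 0 < a₁)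
    (hP : (theta13OfThm1C F N ε₀ ε₂₉ B₃ a₀ a₁).Provisos₁₃Sep F N)
    (Mstar : ℕ) (ops : OpsY N (theta13OfThm1C F N ε₀ ε₂₉ B₃ a₀ a₁).toStage3Params Mstar) (ζ : ResidZ F N) (w : WorldP)
    (hC : w.C = (datumOfRecord₁₃Sep F N (theta13OfThm1C F N ε₀ ε₂₉ B₃ a₀ a₁) hP).C) (hγ : 0 < w.γ ∧ w.γ ≤ (theta13OfThm1C F N ε₀ ε₂₉ B₃ a₀ a₁).γ) (hL : w.L = ((theta13OfThm1C F N ε₀ ε₂₉ B₃ a₀ a₁).L : ℝ))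
    (hup : ∀ P, w.up P = upOfRecord₅C F N ((theta13OfThm1C F N ε₀ ε₂₉ B₃ a₀ a₁).view₁₃B10YZW F N Mstar ops ζ lamW) P)
    (h05 : ∀ P : B12.RunParams,
      B8LeafR ((theta13OfThm1C F N ε₀ ε₂₉ B₃ a₀ a₁).res.X P).d8 ((theta13OfThm1C F N ε₀ ε₂₉ B₃ a₀ a₁).res.X P).L8 ((theta13OfThm1C F N ε₀ ε₂₉ B₃ a₀ a₁).res.X P).C₂ ((theta13OfThm1C F N ε₀ ε₂₉ B₃ a₀ a₁).res.X P).B₁'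
        ((theta13OfThm1C F N ε₀ ε₂₉ B₃ a₀ a₁).res.X P).B₀' ((theta13OfThm1C F N ε₀ ε₂₉ B₃ a₀ a₁).res.X P).B₁ ((theta13OfThm1C F N ε₀ ε₂₉ B₃ a₀ a₁).res.X P).B₂ ((theta13OfThm1C F N ε₀ ε₂₉ B₃ a₀ a₁).res.X P).c₁
        ((theta13OfThm1C F N ε₀ ε₂₉ B₃ a₀ a₁).res.X P).inp8 ((theta13OfThm1C F N ε₀ ε₂₉ B₃ a₀ a₁).res.X P).B₀β ((theta13OfThm1C F N ε₀ ε₂₉ B₃ a₀ a₁).res.X P).loc8 ((theta13OfThm1C F N ε₀ ε₂₉ B₃ a₀ a₁).res.X P).fam8R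
        ((theta13OfThm1C F N ε₀ ε₂₉ B₃ a₀ a₁).res.X P).lan8 ((theta13OfThm1C F N ε₀ ε₂₉ B₃ a₀ a₁).res.X P).cub8 ((theta13OfThm1C F N ε₀ ε₂₉ B₃ a₀ a₁).res.X P).toAxial8)
    (h06 : B9LeafX (Y9OfRecord N (theta13OfThm1C F N ε₀ ε₂₉ B₃ a₀ a₁).toStage3Params Mstar ops))
    (h07 : B11Leaf (Z11OfRecord F N ζ))
    (h08 : PrintedUV3V N (theta13OfThm1C F N ε₀ ε₂₉ B₃ a₀ a₁).L)
    (h09 : ∀ P : B12.RunParams, B12Sec2to5.Lemma4Printed ((theta13OfThm1C F N ε₀ ε₂₉ B₃ a₀ a₁).res.X P).F12 ((theta13OfThm1C F N ε₀ ε₂₉ B₃ a₀ a₁).res.X P).c12)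
    (h09T : ∀ P : B12.RunParams, (leavesP w P).smallCouplings → (leavesP w P).smallFieldInductive)
    (h10 : ∀ P : B12.RunParams, B9LeafX (Y9OfRecord N (theta13OfThm1C F N ε₀ ε₂₉ B₃ a₀ a₁).toStage3Params Mstar ops) →
      (B10.Thm1PrintedCompact (((theta13OfThm1C F N ε₀ ε₂₉ B₃ a₀ a₁).view₁₃B10YZW F N Mstar ops ζ lamW).res.X P).runs10 ∧
          B10.Thm2Printed (((theta13OfThm1C F N ε₀ ε₂₉ B₃ a₀ a₁).view₁₃B10YZW F N Mstar ops ζ lamW).res.X P).runs10) →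
        B11Leaf (Z11OfRecord F N ζ) → B12Sec2to5.Lemma4Printed ((theta13OfThm1C F N ε₀ ε₂₉ B₃ a₀ a₁).res.X P).F12 ((theta13OfThm1C F N ε₀ ε₂₉ B₃ a₀ a₁).res.X P).c12 →
          B13.Lemma1Printed ((theta13OfThm1C F N ε₀ ε₂₉ B₃ a₀ a₁).res.X P).S13 ((theta13OfThm1C F N ε₀ ε₂₉ B₃ a₀ a₁).res.X P).c13 ∧
            B13.Lemma2Printed ((theta13OfThm1C F N ε₀ ε₂₉ B₃ a₀ a₁).res.X P).S13 ((theta13OfThm1C F N ε₀ ε₂₉ B₃ a₀ a₁).res.X P).c13 ∧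
            B13.Lemma3Printed ((theta13OfThm1C F N ε₀ ε₂₉ B₃ a₀ a₁).res.X P).S13 ((theta13OfThm1C F N ε₀ ε₂₉ B₃ a₀ a₁).res.X P).c13)
    (h11 : ∀ P : B12.RunParams, (leavesP w P).b7 → (leavesP w P).b8 → (leavesP w P).b9 → (leavesP w P).b10 → (leavesP w P).b11 →
      (leavesP w P).smallCouplings → (leavesP w P).smallFieldInductive → (leavesP w P).flowControl →
        ∀ k, k < P.K → SLaw₁₃ F N (theta13OfThm1C F N ε₀ ε₂₉ B₃ a₀ a₁) P k → TLaw₁₃ F N (theta13OfThm1C F N ε₀ ε₂₉ B₃ a₀ a₁) P k)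
    (h12deg : ∀ P : B12.RunParams, P.K ≤ lamW.kSel P → B15Leaf (WOfRecord₁₃ F N (theta13OfThm1C F N ε₀ ε₂₉ B₃ a₀ a₁) lamW P))
    (h12pin : ∀ P : B12.RunParams, lamW.kSel P < P.K → lamW.D1100 P
      = rPrimeDataOfSel (reprTOfRecord₁₃ F N (theta13OfThm1C F N ε₀ ε₂₉ B₃ a₀ a₁) P (lamW.kSel P))
          ((theta13OfThm1C F N ε₀ ε₂₉ B₃ a₀ a₁).ppSel P (gOfRecord₁₃ F N (theta13OfThm1C F N ε₀ ε₂₉ B₃ a₀ a₁) P) (lamW.kSel P + 1))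
          (fibOfSeq F (theta13OfThm1C F N ε₀ ε₂₉ B₃ a₀ a₁).ν (theta13OfThm1C F N ε₀ ε₂₉ B₃ a₀ a₁).τ9 P (gOfRecord₁₃ F N (theta13OfThm1C F N ε₀ ε₂₉ B₃ a₀ a₁) P) (lamW.kSel P + 1)))
    (h12mass : ∀ P : B12.RunParams, lamW.kSel P < P.K → ∀ s, LiveSeq F N (theta13OfThm1C F N ε₀ ε₂₉ B₃ a₀ a₁).ν (theta13OfThm1C F N ε₀ ε₂₉ B₃ a₀ a₁).τ9 P (gOfRecord₁₃ F N (theta13OfThm1C F N ε₀ ε₂₉ B₃ a₀ a₁) P) (lamW.kSel P + 1)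
        (slotsTOfRecord F N (theta13OfThm1C F N ε₀ ε₂₉ B₃ a₀ a₁).ν (theta13OfThm1C F N ε₀ ε₂₉ B₃ a₀ a₁).τ9 (EOfRecord₁₃ F N (theta13OfThm1C F N ε₀ ε₂₉ B₃ a₀ a₁)) (wOfRecord₉ F N (theta13OfThm1C F N ε₀ ε₂₉ B₃ a₀ a₁).toStage9Params)
          (theta13OfThm1C F N ε₀ ε₂₉ B₃ a₀ a₁).ppSel P (gOfRecord₁₃ F N (theta13OfThm1C F N ε₀ ε₂₉ B₃ a₀ a₁) P) (lamW.kSel P + 1)) s →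
      0 < ∫ V, rterm (reprTOfRecord₁₃ F N (theta13OfThm1C F N ε₀ ε₂₉ B₃ a₀ a₁) P (lamW.kSel P)) s V ∂(fieldMeasure (F.P P.K) (lamW.kSel P + 1) (SU N)))
    (h12P1 : ∀ P : B12.RunParams, lamW.kSel P < P.K → Prop1Printed (lamW.LF P))
    (h12i180 : ∀ P : B12.RunParams, lamW.kSel P < P.K → ∀ U, new189 (lamW.D189 P) U → ∀ i, (lamW.D189 P).h ≤ i → i ≤ (lamW.D189 P).k →
      ∀ q ∈ plaqsOf (dom (lamW.D189 P) i),
        Ineq180 ((lamW.D189 P).dev0 U q) ((lamW.D189 P).ε (lamW.D189 P).k) (lamW.D189 P).η (lamW.D189 P).B₃ (lamW.D189 P).B₅ (lamW.D189 P).M (lamW.D189 P).δ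
          ((lamW.D189 P).dist q) (lamW.D189 P).O1)
    (h12c189 : ∀ P : B12.RunParams, lamW.kSel P < P.K → Claim189 (new189 (lamW.D189 P)) (chiPP (lamW.D189 P)))
    (hUV : ∀ P : B12.RunParams, (genFlow (betaOfRecord₁₃ F N (theta13OfThm1C F N ε₀ ε₂₉ B₃ a₀ a₁)) P.g0).InInterval w.γ P.K → ∀ k, k ≤ P.K →
      SLaw₁₃ F N (theta13OfThm1C F N ε₀ ε₂₉ B₃ a₀ a₁) P k → ∀ U : GaugeField (F.P P.K) k (SU N),
        chiβOfRecord₁₃ F N (theta13OfThm1C F N ε₀ ε₂₉ B₃ a₀ a₁) P.K (gOfRecord₁₃ F N (theta13OfThm1C F N ε₀ ε₂₉ B₃ a₀ a₁) P) k U *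
              Real.exp (-(1 / (gOfRecord₁₃ F N (theta13OfThm1C F N ε₀ ε₂₉ B₃ a₀ a₁) P k) ^ 2 * wilsonBGOfRecord F N (theta13OfThm1C F N ε₀ ε₂₉ B₃ a₀ a₁).εbg P k U)
                - w.em (gOfRecord₁₃ F N (theta13OfThm1C F N ε₀ ε₂₉ B₃ a₀ a₁) P k) * (Fintype.card (Site (F.P P.K) k) : ℝ)) ≤
            densOfRecord₁₃ F N (theta13OfThm1C F N ε₀ ε₂₉ B₃ a₀ a₁) P k U ∧
        densOfRecord₁₃ F N (theta13OfThm1C F N ε₀ ε₂₉ B₃ a₀ a₁) P k U ≤ Real.exp (w.ep (gOfRecord₁₃ F N (theta13OfThm1C F N ε₀ ε₂₉ B₃ a₀ a₁) P k) * (Fintype.card (Site (F.P P.K) k) : ℝ)))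
    (hlo : BetaLowerH w.b w.γ (datumOfRecord₁₃Sep F N (theta13OfThm1C F N ε₀ ε₂₉ B₃ a₀ a₁) hP).βfun)
    (hhi : BetaUpperH w.βup w.γ (datumOfRecord₁₃Sep F N (theta13OfThm1C F N ε₀ ε₂₉ B₃ a₀ a₁) hP).βfun) :
    ∃ (θ' : Stage13Params F N) (h' : θ'.Provisos₁₃Sep F N), (θ'.ZtUnity F N ∧ θ'.SlotsNondegenerate₁₃ F N) ∧ θ'.Admissible F N ∧
      B16.EndStatementBPrinted (datumOfRecord₁₃Sep F N θ' h').C ∧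
      ∃ γ₁ : ℝ, 0 < γ₁ ∧ ∀ γ : ℝ, 0 < γ → γ ≤ γ₁ → ∃ P : B12.RunParams, 1 ≤ P.K ∧ ((datumOfRecord₁₃Sep F N θ' h').C P).flow.InInterval γ P.K :=
  stabilityBR13Sep_thetaShape18_fourPin_liveRepin₁₃_of_massLive_of_hasResiduals
    (theta13OfNumerics F N (stage12NumericsOfThm1C F.L ε₀ B₃ a₀ a₁) ε₂₉ (zeta316OfRecord F N (stage12NumericsOfThm1C F.L ε₀ B₃ a₀ a₁).ν (stage12NumericsOfThm1C F.L ε₀ B₃ a₀ a₁).τ9.M (stage12NumericsOfThm1C F.L ε₀ B₃ a₀ a₁).A₁) (RzOfRecord F N) (ZtOfRecord F N)) lamW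
    (hasResidualsOfRecord_theta13OfNumerics F N (stage12NumericsOfThm1C F.L ε₀ B₃ a₀ a₁) ε₂₉) hP
    (admissible_theta13OfNumerics F N (zeta316OfRecord F N (stage12NumericsOfThm1C F.L ε₀ B₃ a₀ a₁).ν (stage12NumericsOfThm1C F.L ε₀ B₃ a₀ a₁).τ9.M (stage12NumericsOfThm1C F.L ε₀ B₃ a₀ a₁).A₁) (RzOfRecord F N) (ZtOfRecord F N) (stage12NumericsOfThm1C_pos hε hB ha₀ ha₁) hε')
    (kappa_nonneg_theta13OfThm1C F N ε₀ ε₂₉ B₃ a₀ a₁) (E0_nonneg_theta13OfThm1C F N ε₀ ε₂₉ B₃ a₀ a₁)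
    (B0_nonneg_theta13OfThm1C F N ε₀ ε₂₉ B₃ a₀ a₁) Mstar ops ζ w hC hγ hL hup h05 h06 h07 h08 h09 h09T h10 h11 h12deg h12pin h12mass h12P1 h12i180 h12c189 hUV
    hlo hhi


end Thm1C

end Summit.QuantumFields.YangMills.BalabanUVNodes.N12AtRecord13SepSockets
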